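import Summits.BirchSwinnertonDyer.BirchSwinnertonDyer.Theorems.ResidualThetaTransportAtTwoSignedMuSeedAtTwoPlusJetLevelWall
import HarnessLib

/-!
# The wall BELOW THE THRESHOLD, complete: third-order Taylor and the closed form of `[t^e](S_m + S_m(t ⊕ y_m))` for all `2N ≤ e ≤ 4N − 3`
# after a degenerate level — seed line `jet-character-sums`, stubs J4/J5 (crux `SignedMuSeedAtTwoPlus` stmt-BirchSwinnertonDyer-21438;
# Kμ⁺ stmt-BirchSwinnertonDyer-20689; route `ResidualThetaTransportAtTwo`)

Cell `bsd-wall`, width seat `bsd-wall-rtt-p4-w2` g13 (`--supports`, closes nothing).  THEOREMS ONLY; nothing about any curve, unit or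
`μ`-invariant is asserted; the line is NOT registered (W-79); BSD is not proved by this.

`…JetLevelWall.coeff_levelStep_safeZone` (p678788) gives `[t^e](S + S(t+δ))` for `e < min(3N+v−3, 2N+2v)`, three coefficients short of the
`NonDeg` threshold `4N − 2` when the previous level was degenerate (`v ≥ N − 2`).  This file closes the gap: with the THIRD-order Taylor
formula and one more coefficient of the translation (`δ = ū t^N + c t^{2N} + t^{2N+2}ε'`, the shape of `(t ⊕ y) − t` for `y ∈ k⟦t^N⟧`,
`t ⊕ y = t + y + t²y²H`), for EVERY `e` with `2N ≤ e ≤ 4N − 3`: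

  `[t^e](S + S(t+δ)) = ū·[t^{e−N}](S²) + c·[t^{e−2N}](S²) + ū²·C(e−2N+2, 2)·U_{e−2N+2} + ū³·C(e−3N+3, 3)·U_{e−3N+3}`

(`S' = S²`, `N − 2 ≤ v ≤ ord S`, `2 ≤ v`; `[tⁿ](S²) = [2∣n]·U_{n/2}²` by the square law) — so `NonDeg` at the next level is an explicit
polynomial condition in the coefficients of `S` below `4N`, `ū` and `c`.

* §1 `le_order_binomialRemainder₃`, `hasseTwo_truncSum₃`, `hasseThree_add`, `hasseThree_truncSum₃`, `le_order_sub_truncSum₃`, `truncSum_taylor₃`,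
  **`le_order_taylorRemainder₃`** (`ord(f(t+δ) − f − f'δ − H₂f·δ² − H₃f·δ³) ≥ 4N + v − 4`).
* §2 **`coeff_levelStep_belowThreshold`** (the displayed closed form).

References: the card (J4, J5); `Lines/norm-field-tilt.md` S2 (d); [SilvermanAEC2009] IV.1 for context only.
-/

set_option autoImplicit false
-- the Theorems namespace of this sub repeats the summit name by design (D-0017 nested layout)
set_option linter.dupNamespace false

noncomputable section

open PowerSeries Finset
open Summit.BirchSwinnertonDyer.BirchSwinnertonDyer.Theorems.SignedMuAtTwo.Tilt

namespace Summit.BirchSwinnertonDyer.BirchSwinnertonDyer.Theorems.SignedMuAtTwo.JetCharacterSums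

variable {k : Type*} [CommRing k]

/-! ## §1 Third-order Taylor expansion along `X ↦ X + δ` -/

section Taylor

/-- **Third-order binomial remainder.** `1 ≤ N ≤ ord δ` ⟹
`m + 4N − 1 ≤ ord((X+δ)^{m+3} − X^{m+3} − (m+3)X^{m+2}δ − C(m+3,2)X^{m+1}δ² − C(m+3,3)X^mδ³)`,
by induction through `B_{m+4} = (X+δ)·B_{m+3} + C(m+3,3)·X^m·δ⁴`. [folklore] -/
theorem le_order_binomialRemainder₃ {δ : PowerSeries k} {N : ℕ} (hN : 1 ≤ N) (hδ : (N : ℕ∞) ≤ δ.order) (m : ℕ) :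
    ((m + 4 * N - 1 : ℕ) : ℕ∞) ≤
      ((X + δ) ^ (m + 3) - X ^ (m + 3) - ((m + 3 : ℕ) : PowerSeries k) * X ^ (m + 2) * δ -
        (((m + 3).choose 2 : ℕ) : PowerSeries k) * X ^ (m + 1) * δ ^ 2 -
        (((m + 3).choose 3 : ℕ) : PowerSeries k) * X ^ m * δ ^ 3).order := by
  induction m with
  | zero =>
    have : (X + δ) ^ (0 + 3) - X ^ (0 + 3) - ((0 + 3 : ℕ) : PowerSeries k) * X ^ (0 + 2) * δ -
        (((0 + 3).choose 2 : ℕ) : PowerSeries k) * X ^ (0 + 1) * δ ^ 2 -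
        (((0 + 3).choose 3 : ℕ) : PowerSeries k) * X ^ 0 * δ ^ 3 = 0 := by
      norm_num; ring
    rw [this, order_zero]; exact le_top
  | succ m ih =>
    have hch2 : ((m + 1 + 3).choose 2 : ℕ) = (m + 3).choose 2 + (m + 3) := by
      rw [show m + 1 + 3 = (m + 3) + 1 from rfl, Nat.choose_succ_succ, Nat.choose_one_right, add_comm]
    have hch3 : ((m + 1 + 3).choose 3 : ℕ) = (m + 3).choose 3 + (m + 3).choose 2 := by
      rw [show m + 1 + 3 = (m + 3) + 1 from rfl, Nat.choose_succ_succ, add_comm]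
    have key : (X + δ) ^ (m + 1 + 3) - X ^ (m + 1 + 3) - ((m + 1 + 3 : ℕ) : PowerSeries k) * X ^ (m + 1 + 2) * δ -
        (((m + 1 + 3).choose 2 : ℕ) : PowerSeries k) * X ^ (m + 1 + 1) * δ ^ 2 -
        (((m + 1 + 3).choose 3 : ℕ) : PowerSeries k) * X ^ (m + 1) * δ ^ 3
        = (X + δ) * ((X + δ) ^ (m + 3) - X ^ (m + 3) - ((m + 3 : ℕ) : PowerSeries k) * X ^ (m + 2) * δ -
            (((m + 3).choose 2 : ℕ) : PowerSeries k) * X ^ (m + 1) * δ ^ 2 -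
            (((m + 3).choose 3 : ℕ) : PowerSeries k) * X ^ m * δ ^ 3)
          + (((m + 3).choose 3 : ℕ) : PowerSeries k) * X ^ m * (δ * (δ * (δ * δ))) := by
      rw [hch2, hch3]; push_cast; ring
    rw [key, show m + 1 + 4 * N - 1 = m + 4 * N by omega]
    have h1 : ((1 : ℕ) : ℕ∞) ≤ (X + δ).order :=
      le_order_add_of_le (by simpa using le_order_X_pow (k := k) 1) (le_trans (by exact_mod_cast hN) hδ)
    refine le_order_add_of_le ?_ ?_
    · have := le_order_mul_of_le h1 ih
      rwa [show 1 + (m + 4 * N - 1) = m + 4 * N by omega] at this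
    · have hc : ((0 : ℕ) : ℕ∞) ≤ ((((m + 3).choose 3 : ℕ) : PowerSeries k)).order := by simp
      have := le_order_mul_of_le (le_order_mul_of_le hc (le_order_X_pow (k := k) m))
        (le_order_mul_of_le hδ (le_order_mul_of_le hδ (le_order_mul_of_le hδ hδ)))
      rwa [show 0 + m + (N + (N + (N + N))) = m + 4 * N by omega] at this

/-- The third Hasse derivative `H₃f = Σₙ C(n+3,3)·f_{n+3}·tⁿ` (written as `PowerSeries.mk`) is additive. [folklore] -/
theorem hasseThree_add (f g : PowerSeries k) :
    (PowerSeries.mk fun n => (((n + 3).choose 3 : ℕ) : k) * coeff (n + 3) (f + g)) =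
      (PowerSeries.mk fun n => (((n + 3).choose 3 : ℕ) : k) * coeff (n + 3) f) +
        PowerSeries.mk fun n => (((n + 3).choose 3 : ℕ) : k) * coeff (n + 3) g := by
  ext n; simp only [coeff_mk, map_add, mul_add]

/-- `H₂` of the truncation `f₀ + f₁t + f₂t² + Σ_{d<i} f_{d+3} t^{d+3}` is `f₂ + Σ_{d<i} C(d+3,2) f_{d+3} t^{d+1}`. [folklore] -/
theorem hasseTwo_truncSum₃ (f : PowerSeries k) (i : ℕ) :
    (PowerSeries.mk fun n => (((n + 2).choose 2 : ℕ) : k) *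
        coeff (n + 2) (C (coeff 0 f) + C (coeff 1 f) * X + C (coeff 2 f) * X ^ 2 +
          ∑ d ∈ range i, C (coeff (d + 3) f) * X ^ (d + 3))) =
      C (coeff 2 f) + ∑ d ∈ range i, C ((((d + 3).choose 2 : ℕ) : k) * coeff (d + 3) f) * X ^ (d + 1) := by
  have hne : ∀ n : ℕ, n + 2 ≠ 1 := fun n => by omega
  ext n
  simp only [coeff_mk, map_add, map_sum, coeff_C_mul, coeff_X_pow, coeff_C, coeff_X, mul_ite, mul_one, mul_zero,
    Nat.succ_ne_zero, if_false, zero_add, hne]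
  rcases n with _ | n
  · simp
  · simp only [show n + 1 + 2 ≠ 2 by omega, if_false, zero_add, Nat.succ_ne_zero,
      show ∀ d : ℕ, (n + 1 + 2 = d + 3) ↔ (n = d) from fun d => by omega,
      show ∀ d : ℕ, (n + 1 = d + 1) ↔ (n = d) from fun d => by omega, Finset.sum_ite_eq, Finset.mem_range,
      show n + 1 + 2 = n + 3 from rfl, mul_ite, mul_zero]

/-- `H₃` of the truncation is `Σ_{d<i} C(d+3,3) f_{d+3} t^d`. [folklore] -/
theorem hasseThree_truncSum₃ (f : PowerSeries k) (i : ℕ) :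
    (PowerSeries.mk fun n => (((n + 3).choose 3 : ℕ) : k) *
        coeff (n + 3) (C (coeff 0 f) + C (coeff 1 f) * X + C (coeff 2 f) * X ^ 2 +
          ∑ d ∈ range i, C (coeff (d + 3) f) * X ^ (d + 3))) =
      ∑ d ∈ range i, C ((((d + 3).choose 3 : ℕ) : k) * coeff (d + 3) f) * X ^ d := by
  have hne1 : ∀ n : ℕ, n + 3 ≠ 1 := fun n => by omega
  have hne2 : ∀ n : ℕ, n + 3 ≠ 2 := fun n => by omega
  ext n
  simp only [coeff_mk, map_add, map_sum, coeff_C_mul, coeff_X_pow, coeff_C, coeff_X, mul_ite, mul_one, mul_zero,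
    Nat.succ_ne_zero, if_false, zero_add, hne1, hne2, add_left_inj, Finset.sum_ite_eq, Finset.mem_range]

/-- The truncation differs from `f` in order `≥ i + 3`. [folklore] -/
theorem le_order_sub_truncSum₃ (f : PowerSeries k) (i : ℕ) :
    ((i + 3 : ℕ) : ℕ∞) ≤ (f - (C (coeff 0 f) + C (coeff 1 f) * X + C (coeff 2 f) * X ^ 2 +
      ∑ d ∈ range i, C (coeff (d + 3) f) * X ^ (d + 3))).order := by
  refine nat_le_order _ _ fun j hj => ?_
  simp only [map_sub, map_add, map_sum, coeff_C_mul, coeff_X_pow, coeff_C, coeff_X, mul_ite, mul_one, mul_zero]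
  rcases j with _ | _ | _ | j
  · simp
  · simp
  · simp
  · have hne1 : j + 1 + 1 + 1 ≠ 1 := by omega
    have hne2 : j + 1 + 1 + 1 ≠ 2 := by omega
    simp only [Nat.succ_ne_zero, if_false, zero_add, hne1, hne2, add_left_inj, Finset.sum_ite_eq, Finset.mem_range]
    rw [if_pos (by omega), sub_self]

/-- Exact third-order Taylor formula for the truncated sums. [folklore] -/
theorem truncSum_taylor₃ (f δ : PowerSeries k) (hδ : constantCoeff δ = 0) (i : ℕ) :
    (C (coeff 0 f) + C (coeff 1 f) * X + C (coeff 2 f) * X ^ 2 + ∑ d ∈ range i, C (coeff (d + 3) f) * X ^ (d + 3)).subst (X + δ)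
      - (C (coeff 0 f) + C (coeff 1 f) * X + C (coeff 2 f) * X ^ 2 + ∑ d ∈ range i, C (coeff (d + 3) f) * X ^ (d + 3))
      - d⁄dX k (C (coeff 0 f) + C (coeff 1 f) * X + C (coeff 2 f) * X ^ 2 + ∑ d ∈ range i, C (coeff (d + 3) f) * X ^ (d + 3)) * δ
      - (C (coeff 2 f) + ∑ d ∈ range i, C ((((d + 3).choose 2 : ℕ) : k) * coeff (d + 3) f) * X ^ (d + 1)) * δ ^ 2
      - (∑ d ∈ range i, C ((((d + 3).choose 3 : ℕ) : k) * coeff (d + 3) f) * X ^ d) * δ ^ 3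
    = ∑ d ∈ range i, C (coeff (d + 3) f) *
        ((X + δ) ^ (d + 3) - X ^ (d + 3) - ((d + 3 : ℕ) : PowerSeries k) * X ^ (d + 2) * δ -
          (((d + 3).choose 2 : ℕ) : PowerSeries k) * X ^ (d + 1) * δ ^ 2 -
          (((d + 3).choose 3 : ℕ) : PowerSeries k) * X ^ d * δ ^ 3) := by
  have hs : HasSubst (X + δ) := hasSubst_X_add hδ
  have hsub : (C (coeff 0 f) + C (coeff 1 f) * X + C (coeff 2 f) * X ^ 2 +
      ∑ d ∈ range i, C (coeff (d + 3) f) * X ^ (d + 3)).subst (X + δ)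
      = C (coeff 0 f) + C (coeff 1 f) * (X + δ) + C (coeff 2 f) * (X + δ) ^ 2 +
        ∑ d ∈ range i, C (coeff (d + 3) f) * (X + δ) ^ (d + 3) := by
    rw [← coe_substAlgHom hs]
    simp only [map_add, map_sum, map_mul, map_pow, C_eq_algebraMap, AlgHom.commutes]
    rw [coe_substAlgHom hs, subst_X hs]
  have hder : d⁄dX k (C (coeff 0 f) + C (coeff 1 f) * X + C (coeff 2 f) * X ^ 2 +
      ∑ d ∈ range i, C (coeff (d + 3) f) * X ^ (d + 3))
      = C (coeff 1 f) + C (coeff 2 f) * (2 * X) +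
        ∑ d ∈ range i, C (coeff (d + 3) f) * (((d + 3 : ℕ) : PowerSeries k) * X ^ (d + 2)) := by
    simp only [map_add, map_sum, derivative_C, zero_add]
    rw [Derivation.leibniz, derivative_C, derivative_X, smul_zero, add_zero, smul_eq_mul, mul_one,
      Derivation.leibniz, derivative_C, smul_zero, add_zero, smul_eq_mul, derivative_pow k, derivative_X, mul_one,
      pow_one, Nat.cast_two]
    congr 1
    refine Finset.sum_congr rfl fun d _ => ?_
    rw [Derivation.leibniz, derivative_C, smul_zero, add_zero, smul_eq_mul, derivative_pow k, derivative_X,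
      mul_one, show d + 3 - 1 = d + 2 from rfl]
  have hC2 : ∀ d : ℕ, C ((((d + 3).choose 2 : ℕ) : k) * coeff (d + 3) f) =
      C (coeff (d + 3) f) * (((d + 3).choose 2 : ℕ) : PowerSeries k) := by
    intro d; rw [map_mul, map_natCast, mul_comm]
  have hC3 : ∀ d : ℕ, C ((((d + 3).choose 3 : ℕ) : k) * coeff (d + 3) f) =
      C (coeff (d + 3) f) * (((d + 3).choose 3 : ℕ) : PowerSeries k) := by
    intro d; rw [map_mul, map_natCast, mul_comm]
  simp_rw [hC2, hC3]
  rw [hsub, hder, add_mul, add_mul, add_mul, Finset.sum_mul, Finset.sum_mul, Finset.sum_mul]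
  have : C (coeff 0 f) + C (coeff 1 f) * (X + δ) + C (coeff 2 f) * (X + δ) ^ 2 +
        ∑ d ∈ range i, C (coeff (d + 3) f) * (X + δ) ^ (d + 3)
      - (C (coeff 0 f) + C (coeff 1 f) * X + C (coeff 2 f) * X ^ 2 + ∑ d ∈ range i, C (coeff (d + 3) f) * X ^ (d + 3))
      - (C (coeff 1 f) * δ + C (coeff 2 f) * (2 * X) * δ +
          ∑ d ∈ range i, C (coeff (d + 3) f) * (((d + 3 : ℕ) : PowerSeries k) * X ^ (d + 2)) * δ)
      - (C (coeff 2 f) * δ ^ 2 + ∑ d ∈ range i, C (coeff (d + 3) f) * (((d + 3).choose 2 : ℕ) : PowerSeries k) * X ^ (d + 1) * δ ^ 2)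
      - ∑ d ∈ range i, C (coeff (d + 3) f) * (((d + 3).choose 3 : ℕ) : PowerSeries k) * X ^ d * δ ^ 3
      = ∑ d ∈ range i, C (coeff (d + 3) f) * (X + δ) ^ (d + 3) - ∑ d ∈ range i, C (coeff (d + 3) f) * X ^ (d + 3)
        - ∑ d ∈ range i, C (coeff (d + 3) f) * (((d + 3 : ℕ) : PowerSeries k) * X ^ (d + 2)) * δ
        - ∑ d ∈ range i, C (coeff (d + 3) f) * (((d + 3).choose 2 : ℕ) : PowerSeries k) * X ^ (d + 1) * δ ^ 2
        - ∑ d ∈ range i, C (coeff (d + 3) f) * (((d + 3).choose 3 : ℕ) : PowerSeries k) * X ^ d * δ ^ 3 := by ring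
  rw [this, ← Finset.sum_sub_distrib, ← Finset.sum_sub_distrib, ← Finset.sum_sub_distrib, ← Finset.sum_sub_distrib]
  exact Finset.sum_congr rfl fun d _ => by ring

/-- **Third-order Taylor bound.** For `f, δ ∈ k⟦X⟧` with `1 ≤ N ≤ ord δ` and `v ≤ ord f`:
`4N + v − 4 ≤ ord(f(X+δ) − f − f'·δ − H₂f·δ² − H₃f·δ³)`. [folklore] -/
theorem le_order_taylorRemainder₃ {f δ : PowerSeries k} {N v : ℕ} (hN : 1 ≤ N) (hδ : (N : ℕ∞) ≤ δ.order)
    (hf : (v : ℕ∞) ≤ f.order) :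
    ((4 * N + v - 4 : ℕ) : ℕ∞) ≤
      PowerSeries.order ((f.subst (X + δ) : PowerSeries k) - f - d⁄dX k f * δ -
        (PowerSeries.mk fun n => (((n + 2).choose 2 : ℕ) : k) * coeff (n + 2) f) * δ ^ 2 -
        (PowerSeries.mk fun n => (((n + 3).choose 3 : ℕ) : k) * coeff (n + 3) f) * δ ^ 3) := by
  have hδ0 : constantCoeff δ = 0 := by
    have h0 := coeff_of_lt_order (φ := δ) 0 (lt_of_lt_of_le (by exact_mod_cast hN) hδ)
    rwa [coeff_zero_eq_constantCoeff_apply] at h0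
  have hs : HasSubst (X + δ) := hasSubst_X_add hδ0
  have hXδ : constantCoeff (X + δ) = 0 := by simp [hδ0]
  refine nat_le_order _ _ fun i hi => ?_
  set P : PowerSeries k := C (coeff 0 f) + C (coeff 1 f) * X + C (coeff 2 f) * X ^ 2 +
    ∑ d ∈ range i, C (coeff (d + 3) f) * X ^ (d + 3) with hP
  set g : PowerSeries k := f - P with hg
  have hgord : ((i + 3 : ℕ) : ℕ∞) ≤ g.order := le_order_sub_truncSum₃ f i
  have hfPg : f = P + g := by rw [hg]; ring
  have hH₂ : (PowerSeries.mk fun n => (((n + 2).choose 2 : ℕ) : k) * coeff (n + 2) f) =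
      (C (coeff 2 f) + ∑ d ∈ range i, C ((((d + 3).choose 2 : ℕ) : k) * coeff (d + 3) f) * X ^ (d + 1)) +
        PowerSeries.mk fun n => (((n + 2).choose 2 : ℕ) : k) * coeff (n + 2) g := by
    conv_lhs => rw [hfPg]
    rw [hasseTwo_add, hP, hasseTwo_truncSum₃]
  have hH₃ : (PowerSeries.mk fun n => (((n + 3).choose 3 : ℕ) : k) * coeff (n + 3) f) =
      (∑ d ∈ range i, C ((((d + 3).choose 3 : ℕ) : k) * coeff (d + 3) f) * X ^ d) +
        PowerSeries.mk fun n => (((n + 3).choose 3 : ℕ) : k) * coeff (n + 3) g := by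
    conv_lhs => rw [hfPg]
    rw [hasseThree_add, hP, hasseThree_truncSum₃]
  have hsf : f.subst (X + δ) = P.subst (X + δ) + g.subst (X + δ) := by
    conv_lhs => rw [hfPg]
    rw [subst_add hs]
  have hdf : d⁄dX k f = d⁄dX k P + d⁄dX k g := by rw [← map_add, ← hfPg]
  have hsplit : (f.subst (X + δ) : PowerSeries k) - f - d⁄dX k f * δ -
      (PowerSeries.mk fun n => (((n + 2).choose 2 : ℕ) : k) * coeff (n + 2) f) * δ ^ 2 -
      (PowerSeries.mk fun n => (((n + 3).choose 3 : ℕ) : k) * coeff (n + 3) f) * δ ^ 3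
      = ((P.subst (X + δ) : PowerSeries k) - P - d⁄dX k P * δ -
          (C (coeff 2 f) + ∑ d ∈ range i, C ((((d + 3).choose 2 : ℕ) : k) * coeff (d + 3) f) * X ^ (d + 1)) * δ ^ 2 -
          (∑ d ∈ range i, C ((((d + 3).choose 3 : ℕ) : k) * coeff (d + 3) f) * X ^ d) * δ ^ 3)
        + ((g.subst (X + δ) : PowerSeries k) - g - d⁄dX k g * δ -
          (PowerSeries.mk fun n => (((n + 2).choose 2 : ℕ) : k) * coeff (n + 2) g) * δ ^ 2 -
          (PowerSeries.mk fun n => (((n + 3).choose 3 : ℕ) : k) * coeff (n + 3) g) * δ ^ 3) := by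
    rw [hH₂, hH₃, hsf, hdf]
    linear_combination (-1 : PowerSeries k) * hfPg
  rw [hsplit, map_add]
  have hPpiece : ((4 * N + v - 4 : ℕ) : ℕ∞) ≤
      PowerSeries.order ((P.subst (X + δ) : PowerSeries k) - P - d⁄dX k P * δ -
        (C (coeff 2 f) + ∑ d ∈ range i, C ((((d + 3).choose 2 : ℕ) : k) * coeff (d + 3) f) * X ^ (d + 1)) * δ ^ 2 -
        (∑ d ∈ range i, C ((((d + 3).choose 3 : ℕ) : k) * coeff (d + 3) f) * X ^ d) * δ ^ 3) := by
    rw [hP, truncSum_taylor₃ f δ hδ0 i]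
    refine le_order_sum _ _ fun d _ => ?_
    by_cases hd : d + 3 < v
    · rw [coeff_of_lt_order (d + 3) (lt_of_lt_of_le (by exact_mod_cast hd) hf), map_zero, zero_mul, order_zero]
      exact le_top
    · have hB := le_order_binomialRemainder₃ (k := k) hN hδ d
      have hc : ((0 : ℕ) : ℕ∞) ≤ (C (coeff (d + 3) f) : PowerSeries k).order := by simp
      refine le_trans ?_ (le_order_mul_of_le hc hB)
      exact_mod_cast (by omega)
  have h1 : coeff i (g.subst (X + δ)) = 0 :=
    coeff_of_lt_order i (lt_of_lt_of_le (by exact_mod_cast (by omega : i < i + 3))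
      (hgord.trans (le_order_subst_left' hXδ)))
  have h2 : coeff i g = 0 := coeff_of_lt_order i (lt_of_lt_of_le (by exact_mod_cast (by omega : i < i + 3)) hgord)
  have h3 : coeff i (d⁄dX k g * δ) = 0 := by
    refine coeff_of_lt_order i (lt_of_lt_of_le ?_ (le_order_mul_of_le (le_order_derivative hgord) hδ))
    exact_mod_cast (by omega)
  have hH₂g : (((i + 1 : ℕ)) : ℕ∞) ≤ (PowerSeries.mk fun n => (((n + 2).choose 2 : ℕ) : k) * coeff (n + 2) g).order := by
    refine nat_le_order _ _ fun j hj => ?_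
    rw [coeff_mk, coeff_of_lt_order (j + 2) (lt_of_lt_of_le (by exact_mod_cast (by omega)) hgord), mul_zero]
  have hH₃g : ((i : ℕ) : ℕ∞) ≤ (PowerSeries.mk fun n => (((n + 3).choose 3 : ℕ) : k) * coeff (n + 3) g).order := by
    refine nat_le_order _ _ fun j hj => ?_
    rw [coeff_mk, coeff_of_lt_order (j + 3) (lt_of_lt_of_le (by exact_mod_cast (by omega)) hgord), mul_zero]
  have h4 : coeff i ((PowerSeries.mk fun n => (((n + 2).choose 2 : ℕ) : k) * coeff (n + 2) g) * δ ^ 2) = 0 := by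
    refine coeff_of_lt_order i (lt_of_lt_of_le ?_ (le_order_mul_of_le hH₂g ((le_order_mul_of_le hδ hδ).trans
      (by rw [sq]))))
    exact_mod_cast (by omega)
  have h5 : coeff i ((PowerSeries.mk fun n => (((n + 3).choose 3 : ℕ) : k) * coeff (n + 3) g) * δ ^ 3) = 0 := by
    refine coeff_of_lt_order i (lt_of_lt_of_le ?_ (le_order_mul_of_le hH₃g
      ((le_order_mul_of_le hδ (le_order_mul_of_le hδ hδ)).trans (by rw [pow_three]))))
    exact_mod_cast (by omega)
  rw [coeff_of_lt_order i (lt_of_lt_of_le (by exact_mod_cast hi) hPpiece), map_sub, map_sub, map_sub, map_sub, h1, h2, h3,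
    h4, h5]
  simp

end Taylor

/-! ## §2 The wall below the threshold, complete -/

section Wall

variable [CharP k 2] {S δ ε : PowerSeries k} {u c : k} {N v e : ℕ}

include S δ ε u c N v e in
/-- **The wall below the threshold.**  `S' = S·S`, `v ≤ ord S` with `2 ≤ v` and `N ≤ v + 2` (the previous level was degenerate), `1 ≤ N`,
`δ = ū t^N + c t^{2N} + t^{2N+2}ε'` (the shape of `(t ⊕ y) − t`, `y ∈ k⟦t^N⟧`); then for EVERY `e` with `2N ≤ e ≤ 4N − 3`:
`[t^e](S + S(t+δ)) = ū·[t^{e−N}](S·S) + c·[t^{e−2N}](S·S) + ū²·C(e−2N+2, 2)·U_{e−2N+2} + ū³·C(e+3−3N, 3)·U_{e+3−3N}`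
(the last term is absent, `C(≤2,3) = 0`, while `e + 3 < 3N`). [folklore] -/
theorem coeff_levelStep_belowThreshold (hN : 1 ≤ N) (hR : d⁄dX k S = S * S) (hv : (v : ℕ∞) ≤ S.order) (hv2 : 2 ≤ v)
    (hvN : N ≤ v + 2) (hδ : δ = C u * X ^ N + C c * X ^ (2 * N) + X ^ (2 * N + 2) * ε) (h2N : 2 * N ≤ e) (he : e + 3 ≤ 4 * N) :
    coeff e (S + S.subst (X + δ)) =
      u * coeff (e - N) (S * S) + c * coeff (e - 2 * N) (S * S) +
        u ^ 2 * ((((e - 2 * N + 2).choose 2 : ℕ) : k) * coeff (e - 2 * N + 2) S) +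
        u ^ 3 * ((((e + 3 - 3 * N).choose 3 : ℕ) : k) * coeff (e + 3 - 3 * N) S) := by
  have h2P := two_eq_zero_powerSeries (k := k)
  -- `δ = ū t^N + t^{2N} θ`, `θ = c + t²ε'`
  set θ : PowerSeries k := C c + X ^ 2 * ε with hθ
  have hδθ : δ = C u * X ^ N + X ^ (2 * N) * θ := by rw [hδ, hθ]; ring
  have hδord : (N : ℕ∞) ≤ δ.order := by
    rw [hδθ]
    refine le_order_add_of_le ?_ ?_
    · have := le_order_mul_of_le (show ((0 : ℕ) : ℕ∞) ≤ (C u : PowerSeries k).order by simp) (le_order_X_pow (k := k) N)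
      simpa using this
    · have := le_order_mul_of_le (le_order_X_pow (k := k) (2 * N)) (show ((0 : ℕ) : ℕ∞) ≤ θ.order by simp)
      exact le_trans (by exact_mod_cast (by omega)) this
  have hT := le_order_taylorRemainder₃ hN hδord hv
  set R : PowerSeries k := S.subst (X + δ) - S - d⁄dX k S * δ -
    (PowerSeries.mk fun n => (((n + 2).choose 2 : ℕ) : k) * coeff (n + 2) S) * δ ^ 2 -
    (PowerSeries.mk fun n => (((n + 3).choose 3 : ℕ) : k) * coeff (n + 3) S) * δ ^ 3 with hRdef
  have hsum : S + S.subst (X + δ) = S * S * δ +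
      (PowerSeries.mk fun n => (((n + 2).choose 2 : ℕ) : k) * coeff (n + 2) S) * δ ^ 2 +
      (PowerSeries.mk fun n => (((n + 3).choose 3 : ℕ) : k) * coeff (n + 3) S) * δ ^ 3 + R := by
    rw [hRdef, ← hR]; linear_combination Tilt.add_self_eq_zero S
  -- powers of `δ` in characteristic `2`
  have hδsq : δ ^ 2 = C u ^ 2 * X ^ (2 * N) + X ^ (4 * N) * θ ^ 2 := by
    rw [hδθ, show 4 * N = 2 * (2 * N) from by ring, pow_mul, pow_mul]
    linear_combination (C u * X ^ N * (X ^ (2 * N) * θ)) * h2P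
  have hδcube : δ ^ 3 = C u ^ 3 * X ^ (3 * N) + X ^ (4 * N) * (C u ^ 2 * θ + C u * X ^ N * θ ^ 2 + X ^ (2 * N) * θ ^ 3) := by
    rw [pow_succ, hδsq, hδθ, show 4 * N = 2 * (2 * N) from by ring, show 3 * N = 2 * N + N from by ring, pow_add, pow_mul]
    ring
  rw [hsum, hδsq, hδcube, map_add, map_add, map_add]
  have hSS : ((2 * v : ℕ) : ℕ∞) ≤ (S * S).order := by
    have := le_order_mul_of_le hv hv; rwa [show v + v = 2 * v by ring] at this
  -- (1) `S²·δ`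
  have hA : coeff e (S * S * δ) = u * coeff (e - N) (S * S) + c * coeff (e - 2 * N) (S * S) := by
    rw [hδθ, hθ, mul_add, mul_add, mul_add, map_add, map_add,
      show S * S * (C u * X ^ N) = C u * (X ^ N * (S * S)) by ring, coeff_C_mul, coeff_X_pow_mul', if_pos (by omega),
      show S * S * (X ^ (2 * N) * C c) = C c * (X ^ (2 * N) * (S * S)) by ring, coeff_C_mul, coeff_X_pow_mul', if_pos h2N,
      show S * S * (X ^ (2 * N) * (X ^ 2 * ε)) = X ^ (2 * N + 2) * (S * S * ε) by ring, coeff_X_pow_mul']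
    have hz : coeff (e - (2 * N + 2)) (S * S * ε) = 0 :=
      coeff_of_lt_order _ (lt_of_lt_of_le (by exact_mod_cast (by omega))
        (le_order_mul_of_le hSS (show ((0 : ℕ) : ℕ∞) ≤ ε.order by simp)))
    rw [hz]; split_ifs <;> ring
  -- (2) `H₂S·δ²`
  have hH2ord : (((v - 2 : ℕ)) : ℕ∞) ≤ (PowerSeries.mk fun n => (((n + 2).choose 2 : ℕ) : k) * coeff (n + 2) S).order := by
    refine nat_le_order _ _ fun j hj => ?_
    rw [coeff_mk, coeff_of_lt_order (j + 2) (lt_of_lt_of_le (by exact_mod_cast (by omega)) hv), mul_zero]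
  have hB : coeff e ((PowerSeries.mk fun n => (((n + 2).choose 2 : ℕ) : k) * coeff (n + 2) S) *
      (C u ^ 2 * X ^ (2 * N) + X ^ (4 * N) * θ ^ 2)) =
      u ^ 2 * ((((e - 2 * N + 2).choose 2 : ℕ) : k) * coeff (e - 2 * N + 2) S) := by
    rw [mul_add, map_add, ← map_pow,
      show (PowerSeries.mk fun n => (((n + 2).choose 2 : ℕ) : k) * coeff (n + 2) S) * (C (u ^ 2) * X ^ (2 * N)) =
        C (u ^ 2) * (X ^ (2 * N) * PowerSeries.mk fun n => (((n + 2).choose 2 : ℕ) : k) * coeff (n + 2) S) by ring,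
      coeff_C_mul, coeff_X_pow_mul', if_pos h2N, coeff_mk,
      show (PowerSeries.mk fun n => (((n + 2).choose 2 : ℕ) : k) * coeff (n + 2) S) * (X ^ (4 * N) * θ ^ 2) =
        X ^ (4 * N) * ((PowerSeries.mk fun n => (((n + 2).choose 2 : ℕ) : k) * coeff (n + 2) S) * θ ^ 2) by ring,
      coeff_X_pow_mul', if_neg (by omega), add_zero]
  -- (3) `H₃S·δ³`
  have hH3ord : (((v - 3 : ℕ)) : ℕ∞) ≤ (PowerSeries.mk fun n => (((n + 3).choose 3 : ℕ) : k) * coeff (n + 3) S).order := by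
    refine nat_le_order _ _ fun j hj => ?_
    rw [coeff_mk, coeff_of_lt_order (j + 3) (lt_of_lt_of_le (by exact_mod_cast (by omega)) hv), mul_zero]
  have hC4 : coeff e (X ^ (4 * N) * ((PowerSeries.mk fun n => (((n + 3).choose 3 : ℕ) : k) * coeff (n + 3) S) *
      (C u ^ 2 * θ + C u * X ^ N * θ ^ 2 + X ^ (2 * N) * θ ^ 3))) = 0 := by
    rw [coeff_X_pow_mul', if_neg (by omega)]
  have hC3 : coeff e (C (u ^ 3) * (X ^ (3 * N) * PowerSeries.mk fun n => (((n + 3).choose 3 : ℕ) : k) * coeff (n + 3) S)) =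
      u ^ 3 * ((((e + 3 - 3 * N).choose 3 : ℕ) : k) * coeff (e + 3 - 3 * N) S) := by
    rw [coeff_C_mul, coeff_X_pow_mul']
    split_ifs with h3N
    · rw [coeff_mk, show e - 3 * N + 3 = e + 3 - 3 * N by omega]
    · rw [Nat.choose_eq_zero_of_lt (by omega : e + 3 - 3 * N < 3), Nat.cast_zero, zero_mul, mul_zero]
  have hC' : coeff e ((PowerSeries.mk fun n => (((n + 3).choose 3 : ℕ) : k) * coeff (n + 3) S) *
      (C u ^ 3 * X ^ (3 * N) + X ^ (4 * N) * (C u ^ 2 * θ + C u * X ^ N * θ ^ 2 + X ^ (2 * N) * θ ^ 3))) =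
      u ^ 3 * ((((e + 3 - 3 * N).choose 3 : ℕ) : k) * coeff (e + 3 - 3 * N) S) := by
    rw [mul_add, map_add, ← map_pow,
      show (PowerSeries.mk fun n => (((n + 3).choose 3 : ℕ) : k) * coeff (n + 3) S) * (C (u ^ 3) * X ^ (3 * N)) =
        C (u ^ 3) * (X ^ (3 * N) * PowerSeries.mk fun n => (((n + 3).choose 3 : ℕ) : k) * coeff (n + 3) S) by ring,
      hC3,
      show (PowerSeries.mk fun n => (((n + 3).choose 3 : ℕ) : k) * coeff (n + 3) S) *
          (X ^ (4 * N) * (C u ^ 2 * θ + C u * X ^ N * θ ^ 2 + X ^ (2 * N) * θ ^ 3)) =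
        X ^ (4 * N) * ((PowerSeries.mk fun n => (((n + 3).choose 3 : ℕ) : k) * coeff (n + 3) S) *
          (C u ^ 2 * θ + C u * X ^ N * θ ^ 2 + X ^ (2 * N) * θ ^ 3)) by ring,
      hC4, add_zero]
  -- (4) the remainder
  have hlt : ((e : ℕ) : ℕ∞) < ((4 * N + v - 4 : ℕ) : ℕ∞) := by exact_mod_cast (by omega)
  have hD : coeff e R = 0 := coeff_of_lt_order _ (lt_of_lt_of_le hlt hT)
  rw [hA, hB, hC', hD, add_zero]

end Wall

end Summit.BirchSwinnertonDyer.BirchSwinnertonDyer.Theorems.SignedMuAtTwo.JetCharacterSums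

end
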